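import Literature.NumberTheory.ComplexMultiplication.CMTypeRankIrreducibleSlot
import Literature.AlgebraicGeometry.Pohlmann1968.SimpleCMAbelianVarietyPowersDivisorGenerated
import Summits.HodgeConjecture.CorCM.GenericSexticThreefoldTimesCMHodge
import HarnessLib

/-!
# CM fields with DOUBLE FLIPS: every CM type is nondegenerate with IRREDUCIBLE odd module, and such a field pairs
# additively with every CM field of smaller degree — octic fields with even sign kernel against curves, surfaces, threefolds

COR-CM (cell `pub-hodgecm2`, binder seat `b16` gen 46, count-neutral claim PRIME-SLOT, file F8; theorems only, no
definition, no named fact, no `sorry`).  NEW as stated, hence under `Summits/`.  The tree's pair-flip slot theory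
(`Literature/…/CMTypeRankIrreducibleSlot`: a PAIR FLIP at every embedding — `σ ∘ s = s̄`, `σ` trivial off `{s, s̄}` — makes
the odd weights irreducible, every type nondegenerate, and excludes common constituents with smaller slots,
`pairwise_of_irreducible_of_finrank_le`) asks for the full sign group `(ℤ₂)ⁿ ≤ Gal(Kᶜ/ℚ)`.  This file runs the same engine
on DOUBLE FLIPS — for all embeddings `s`, `t` in different conjugate pairs some `σ ∈ Aut(ℂ)` conjugates exactly the two
pairs of `s` and `t` — i.e. on the EVEN sign kernel `(ℤ₂)ⁿ⁻¹_{even} ≤ Gal(Kᶜ/ℚ)` (Dodson's `v = n − 1`; for octic fields: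
Galois closures of degree `32, 64, 96, 192` with `v = 3`), provided there are at least THREE pairs:

* §1 (abstract, ns `…CorCM.DoubleFlip`) `sub_comp_add_comp_eq` — for an odd weight `f`, the double flip `φ` at `x, t`
  and the double flip `φ′` at `t, t′`: `(f − f∘φ) + (f − f∘φ)∘φ′ = 4 f(x)·(δ_x − δ_{x̄})`; hence
  **`eq_antiWeights_of_stable_of_doubleFlip`** (the odd weights are IRREDUCIBLE), `antiSpan_eq_antiWeights_of_doubleFlip`,
  **`typeRank_eq_of_doubleFlip`** (EVERY CM type is nondegenerate), `antiSpan_irreducible_of_doubleFlip`.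
* §2 (CM fields) `isNondegenerate_of_doubleFlip`; **`pairwise_of_doubleFlip_of_finrank_lt`** — a double-flip field `K_i`
  against ANY `K_j` with `[K_j : ℚ] < [K_i : ℚ]`: no common constituent, both orders (`U(Φ_i)` irreducible of dimension
  `[K_i:ℚ]/2 > dim U(Φ_j)`); **`isNondegenerateFamily_iff_of_doubleFlip_of_finrank_lt`** — two slots: nondegenerate ⟺
  `Φ_j` nondegenerate (NO shared-field clause: a double-flip field of degree `≥ 6` has no imaginary quadratic subfield to
  share); `hodgeConjectureFor_prod_of_doubleFlip_of_finrank_lt` (realisations: the Hodge conjecture and `B• = D•` on every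
  `A^a × B^b`, UNCONDITIONALLY).
* §3 the `(4, ≤ 3)` cells: **`hodgeConjectureFor_prod_doubleFlipOctic_simple_dim_le_three`** — a CM abelian FOURFOLD whose
  octic field has double flips (sign kernel of order `≥ 8`: closures of degree `32, 64, 96, 192, 128, 384`) times ANY SIMPLE
  CM abelian variety of dimension `≤ 3`: the Hodge conjecture on all products, with no hypothesis on the fields.  With
  `CorCM/PrimeSlotCoprimeClosureHodge` (closures of `2`-power degree) and this seat's gen-45 reflex/twin theorems this leaves,
  in the `(3,4)` cell of dimension `7`, only octic fields with Galois closure of degree `24` or `48`.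

HONEST FRAMING: the Hodge conjecture for NAMED classes of CM abelian varieties; `HC_CM` is neither used nor asserted.

## References

* [Dodson1984] B. Dodson, *The structure of Galois groups of CM-fields*, Trans. AMS 283 (1984), §1.1 (imprimitivity
  sequence, `v`), §5.1, §5.2 (`n = 4`).
* [Gordon1999HodgeAVSurvey] B. B. Gordon, *A survey of the Hodge conjecture for abelian varieties*, §3 Theorem (proof),
  7.5–7.7, 10.10.
* [Serre1977] J.-P. Serre, *Linear Representations of Finite Groups*, GTM 42, §1.3, §2.2.
-/

noncomputable section

open scoped BigOperators

/-! ## §1 Abstract: double flips make the odd weights irreducible -/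

namespace Summit.HodgeConjecture.CorCM.DoubleFlip

open Literature.NumberTheory.ComplexMultiplication

variable {G : Type*} [Group G] {X : Type*} [MulAction G X] [DecidableEq X]

/-- **`f − f∘φ = 2f(x)(δ_x − δ_{x̄}) + 2f(t)(δ_t − δ_{t̄})` for an odd weight `f` and the double flip `φ` at `x, t`.**
[cite: Gordon1999HodgeAVSurvey, §3 Theorem (proof)] -/
theorem sub_comp_doubleFlip_eq {ρ : G} (hρ : ∀ x : X, ρ • ρ • x = x)
    (hcomm : ∀ (g : G) (x : X), g • ρ • x = ρ • g • x) (hfree : ∀ x : X, ρ • x ≠ x) {f : X → ℚ}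
    (hf : f ∈ antiWeights (E := X) ρ) {x t : X} (htx : t ≠ x) (htx' : t ≠ ρ • x) {φ : G} (hφx : φ • x = ρ • x)
    (hφt : φ • t = ρ • t) (hφ : ∀ y : X, y ≠ x → y ≠ ρ • x → y ≠ t → y ≠ ρ • t → φ • y = y) :
    (f - fun y => f (φ • y)) = (2 * f x) • (Pi.single x (1 : ℚ) - Pi.single (ρ • x) 1 : X → ℚ) +
      (2 * f t) • (Pi.single t (1 : ℚ) - Pi.single (ρ • t) 1 : X → ℚ) := by
  rw [mem_antiWeights_iff'] at hf
  have hφρx : φ • ρ • x = x := by rw [hcomm, hφx, hρ]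
  have hφρt : φ • ρ • t = t := by rw [hcomm, hφt, hρ]
  have hxρt : x ≠ ρ • t := fun h => htx' (by rw [h, hρ])
  have hρxt : ρ • x ≠ t := fun h => htx' h.symm
  have hρxρt : ρ • x ≠ ρ • t := fun h => htx (by simpa [hρ] using (congrArg (ρ • ·) h).symm)
  funext z
  simp only [Pi.sub_apply, Pi.add_apply, Pi.smul_apply, Pi.single_apply, smul_eq_mul]
  by_cases hzx : z = x
  · subst hzx
    simp only [hφx, hf z, if_true, if_neg (hfree z).symm, if_neg htx.symm, if_neg hxρt]
    ring
  · by_cases hzρ : z = ρ • x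
    · subst hzρ
      simp only [hφρx, hf x, if_neg hzx, if_true, if_neg hρxt, if_neg hρxρt]
      ring
    · by_cases hzt : z = t
      · subst hzt
        simp only [hφt, hf z, if_neg hzx, if_neg hzρ, if_true, if_neg (hfree z).symm]
        ring
      · by_cases hzρt : z = ρ • t
        · subst hzρt
          simp only [hφρt, hf t, if_neg hzx, if_neg hzρ, if_neg hzt, if_true]
          ring
        · simp only [hφ z hzx hzρ hzt hzρt, if_neg hzx, if_neg hzρ, if_neg hzt, if_neg hzρt]
          ring

variable [Fintype X]

/-- **Double flips make the odd weights irreducible** (at least three conjugate pairs).  Let `G` act transitively on `X`,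
`ρ ∈ G` a commuting fixed-point-free involution, `|X| ≥ 6`, and suppose every two pairs `{x, x̄} ≠ {t, t̄}` are conjugated
by some `φ ∈ G` trivial off them.  Then every non-zero `G`-stable subspace `W` of the odd weights IS the odd weights:
`f ∈ W` with `f(x) ≠ 0`, `φ` the double flip at `x, t` and `φ′` the one at `t, t′` give
`(f − f∘φ) + (f − f∘φ)∘φ′ = 4f(x)(δ_x − δ_{x̄}) ∈ W`, then all `δ_y − δ_{ȳ} ∈ W` by transitivity.
[cite: Serre1977, §1.3] [cite: Dodson1984, §5.1] -/
theorem eq_antiWeights_of_stable_of_doubleFlip [MulAction.IsPretransitive G X] {ρ : G}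
    (hρ : ∀ x : X, ρ • ρ • x = x) (hcomm : ∀ (g : G) (x : X), g • ρ • x = ρ • g • x)
    (hfree : ∀ x : X, ρ • x ≠ x) (h6 : 6 ≤ Fintype.card X)
    (hflip : ∀ x t : X, t ≠ x → t ≠ ρ • x → ∃ φ : G, φ • x = ρ • x ∧ φ • t = ρ • t ∧
      ∀ y : X, y ≠ x → y ≠ ρ • x → y ≠ t → y ≠ ρ • t → φ • y = y)
    {W : Submodule ℚ (X → ℚ)} (hW : W ≤ antiWeights (E := X) ρ) (hW0 : W ≠ ⊥)
    (hst : ∀ (g : G) (f : X → ℚ), f ∈ W → (fun y => f (g • y)) ∈ W) :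
    W = antiWeights (E := X) ρ := by
  obtain ⟨f, hfW, hf0⟩ := (Submodule.ne_bot_iff W).1 hW0
  obtain ⟨x, hx⟩ : ∃ x, f x ≠ 0 := by
    by_contra h
    exact hf0 (funext fun x => by simpa using (not_exists.1 h) x)
  -- two further pairs `t`, `t'`
  have hout : ∀ S : Finset X, S.card ≤ 4 → ∃ y, y ∉ S := fun S hS => by
    by_contra hall
    push Not at hall
    have : Fintype.card X ≤ S.card := by
      rw [← Finset.card_univ]; exact Finset.card_le_card fun y _ => hall y
    omega
  obtain ⟨t, ht⟩ := hout {x, ρ • x} (Finset.card_le_two.trans (by norm_num))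
  simp only [Finset.mem_insert, Finset.mem_singleton, not_or] at ht
  obtain ⟨t', ht'⟩ := hout {x, ρ • x, t, ρ • t} Finset.card_le_four
  simp only [Finset.mem_insert, Finset.mem_singleton, not_or] at ht'
  obtain ⟨φ, hφx, hφt, hφ⟩ := hflip x t ht.1 ht.2
  obtain ⟨φ', hφ't, hφ't', hφ'⟩ := hflip t t' ht'.2.2.1 ht'.2.2.2
  -- `w₁ = f − f∘φ = 2f(x) d_x + 2f(t) d_t ∈ W`
  set dx : X → ℚ := Pi.single x (1 : ℚ) - Pi.single (ρ • x) 1 with hdx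
  set dt : X → ℚ := Pi.single t (1 : ℚ) - Pi.single (ρ • t) 1 with hdt
  have hw₁ : (f - fun y => f (φ • y)) ∈ W := W.sub_mem hfW (hst φ f hfW)
  have hw₁eq : (f - fun y => f (φ • y)) = (2 * f x) • dx + (2 * f t) • dt :=
    sub_comp_doubleFlip_eq hρ hcomm hfree (hW hfW) ht.1 ht.2 hφx hφt hφ
  -- precomposing with `φ'`: `d_x ∘ φ' = d_x`, `d_t ∘ φ' = −d_t`
  have hφ'x : φ' • x = x := hφ' x (Ne.symm ht.1) (fun h => ht.2 (by rw [h, hρ])) (Ne.symm ht'.1)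
    (fun h => ht'.2.1 (by rw [h, hρ]))
  have hdxφ : (fun z => dx (φ' • z)) = dx := by
    rw [hdx, single_sub_single_comp_smul hcomm x φ']
    have : φ'⁻¹ • x = x := by rw [inv_smul_eq_iff, hφ'x]
    rw [this]
  have hdtφ : (fun z => dt (φ' • z)) = -dt := by
    rw [hdt, single_sub_single_comp_smul hcomm t φ']
    have : φ'⁻¹ • t = ρ • t := by rw [inv_smul_eq_iff, hcomm, hφ't, hρ]
    rw [this, hρ, neg_sub]
  have hw₂ : (fun z => (f - fun y => f (φ • y)) (φ' • z)) ∈ W := hst φ' _ hw₁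
  have hsum : (f - fun y => f (φ • y)) + (fun z => (f - fun y => f (φ • y)) (φ' • z)) = (4 * f x) • dx := by
    have e2 : (fun z => (f - fun y => f (φ • y)) (φ' • z)) = (2 * f x) • dx - (2 * f t) • dt := by
      funext z
      have a : dx (φ' • z) = dx z := congrFun hdxφ z
      have b : dt (φ' • z) = -dt z := congrFun hdtφ z
      rw [hw₁eq]
      simp only [Pi.add_apply, Pi.smul_apply, Pi.sub_apply, smul_eq_mul, a, b]
      ring
    rw [e2, hw₁eq]
    funext z
    simp only [Pi.add_apply, Pi.sub_apply, Pi.smul_apply, smul_eq_mul]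
    ring
  have hdxW : dx ∈ W := by
    have h1 : (4 * f x) • dx ∈ W := by rw [← hsum]; exact W.add_mem hw₁ hw₂
    exact (Submodule.smul_mem_iff W (mul_ne_zero (by norm_num) hx)).1 h1
  -- hence `δ_y − δ_{ρy} ∈ W` for all `y`
  have hdy : ∀ y : X, (Pi.single y (1 : ℚ) - Pi.single (ρ • y) 1 : X → ℚ) ∈ W := by
    intro y
    obtain ⟨k, hk⟩ := MulAction.exists_smul_eq G y x
    have h1 := hst k _ hdxW
    rw [hdx, single_sub_single_comp_smul hcomm x k, ← hk, inv_smul_smul] at h1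
    exact h1
  refine le_antisymm hW fun g hg => ?_
  rw [eq_sum_smul_single_sub_of_mem_antiWeights hρ hg]
  exact W.smul_mem _ (W.sum_mem fun y _ => W.smul_mem _ (hdy y))

variable [Nonempty X]

/-- **`U(Φ) = Anti` for every CM type of a double-flip slot with at least three pairs.** [cite: Dodson1984, §5.1] -/
theorem antiSpan_eq_antiWeights_of_doubleFlip [MulAction.IsPretransitive G X] {ρ : G} {Φ : Set X}
    (h : IsCMTypeWith ρ Φ) (h6 : 6 ≤ Fintype.card X)
    (hflip : ∀ x t : X, t ≠ x → t ≠ ρ • x → ∃ φ : G, φ • x = ρ • x ∧ φ • t = ρ • t ∧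
      ∀ y : X, y ≠ x → y ≠ ρ • x → y ≠ t → y ≠ ρ • t → φ • y = y) :
    antiSpan G Φ = antiWeights (E := X) ρ := by
  refine eq_antiWeights_of_stable_of_doubleFlip h.invol h.comm h.rho_smul_ne h6 hflip (antiSpan_le_antiWeights' h)
    ?_ (fun g f hf => comp_smul_mem_antiSpan hf g)
  rw [Submodule.ne_bot_iff]
  refine ⟨antiVec Φ (1 : G), Submodule.subset_span ⟨1, rfl⟩, fun h0 => ?_⟩
  have h1 := congrFun h0 (Classical.arbitrary X)
  simp only [antiVec, Pi.zero_apply] at h1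
  by_cases hm : (1 : G) • Classical.arbitrary X ∈ Φ
  · rw [translateInd_of_mem hm] at h1; norm_num at h1
  · rw [translateInd_of_not_mem hm] at h1; norm_num at h1

/-- **Every CM type of a double-flip slot with at least three pairs is nondegenerate**: `rank(Φ) = |X|/2 + 1`.
[cite: Dodson1984, §5.1] -/
theorem typeRank_eq_of_doubleFlip [MulAction.IsPretransitive G X] {ρ : G} {Φ : Set X} (h : IsCMTypeWith ρ Φ)
    (h6 : 6 ≤ Fintype.card X)
    (hflip : ∀ x t : X, t ≠ x → t ≠ ρ • x → ∃ φ : G, φ • x = ρ • x ∧ φ • t = ρ • t ∧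
      ∀ y : X, y ≠ x → y ≠ ρ • x → y ≠ t → y ≠ ρ • t → φ • y = y) :
    typeRank G Φ = Fintype.card X / 2 + 1 :=
  h.typeRank_eq_iff_antiSpan_eq.2 (antiSpan_eq_antiWeights_of_doubleFlip h h6 hflip)

/-- **`U(Φ)` is irreducible for every CM type of a double-flip slot with at least three pairs.** [cite: Serre1977, §1.3] -/
theorem antiSpan_irreducible_of_doubleFlip [MulAction.IsPretransitive G X] {ρ : G} {Φ : Set X}
    (h : IsCMTypeWith ρ Φ) (h6 : 6 ≤ Fintype.card X)
    (hflip : ∀ x t : X, t ≠ x → t ≠ ρ • x → ∃ φ : G, φ • x = ρ • x ∧ φ • t = ρ • t ∧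
      ∀ y : X, y ≠ x → y ≠ ρ • x → y ≠ t → y ≠ ρ • t → φ • y = y)
    (W : Submodule ℚ (X → ℚ)) (hW : W ≤ antiSpan G Φ) (hW0 : W ≠ ⊥)
    (hst : ∀ (k : G) (f : X → ℚ), f ∈ W → (fun y => f (k • y)) ∈ W) : W = antiSpan G Φ := by
  rw [antiSpan_eq_antiWeights_of_doubleFlip h h6 hflip] at hW ⊢
  exact eq_antiWeights_of_stable_of_doubleFlip h.invol h.comm h.rho_smul_ne h6 hflip hW hW0 hst

end Summit.HodgeConjecture.CorCM.DoubleFlip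

/-! ## §2 CM fields with double flips -/

namespace Summit.HodgeConjecture.CorCM

open CategoryTheory CategoryTheory.Limits NumberField Module
open Literature.NumberTheory.ComplexMultiplication
open Literature.AlgebraicGeometry.Motives (AbelianVariety CMType)
open Literature.AlgebraicGeometry.Motives.AbelianVariety
open Literature.AlgebraicGeometry.HodgeTheory
open Literature.AlgebraicGeometry.ComplexMultiplication (IsCMTypeRealisation isSimple_iff_isPrimitive)
open Literature.AlgebraicGeometry.VanGeemen1994 (hodgeClassSpan)
open Literature.AlgebraicGeometry.Pohlmann1968
open Literature.Barriers.HodgeConjecture (divisorClassesSpan)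

section Fields

variable {I : Type} {K : I → Type} [∀ i, Field (K i)] [∀ i, NumberField (K i)] [∀ i, IsCMField (K i)]

/-- **Every CM type of a CM field of degree `≥ 6` with double flips is nondegenerate, and its odd module is irreducible of
dimension `[K:ℚ]/2`.** [cite: Dodson1984, §5.1] -/
theorem irreducible_and_isNondegenerate_of_doubleFlip (Φ : ∀ i, CMType (K i)) {i : I} (h6 : 6 ≤ finrank ℚ (K i))
    (hflip : ∀ s t : K i →+* ℂ, t ≠ s → t ≠ (starRingAut : ℂ ≃+* ℂ) • s → ∃ σ : ℂ ≃+* ℂ,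
      σ • s = (starRingAut : ℂ ≃+* ℂ) • s ∧ σ • t = (starRingAut : ℂ ≃+* ℂ) • t ∧
      ∀ u : K i →+* ℂ, u ≠ s → u ≠ (starRingAut : ℂ ≃+* ℂ) • s → u ≠ t → u ≠ (starRingAut : ℂ ≃+* ℂ) • t → σ • u = u) :
    (∀ W : Submodule ℚ ((K i →+* ℂ) → ℚ), W ≤ antiSpan (ℂ ≃+* ℂ) (Φ i).1 → W ≠ ⊥ →
      (∀ (k : ℂ ≃+* ℂ) (f : (K i →+* ℂ) → ℚ), f ∈ W → (fun y => f (k • y)) ∈ W) →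
        W = antiSpan (ℂ ≃+* ℂ) (Φ i).1) ∧
    finrank ℚ (antiSpan (ℂ ≃+* ℂ) (Φ i).1) = finrank ℚ (K i) / 2 ∧ IsNondegenerate (Φ i) := by
  classical
  haveI := isPretransitive_ringEquiv_complex (K := K i)
  have h6' : 6 ≤ Fintype.card (K i →+* ℂ) := by rw [Embeddings.card]; exact h6
  have hnd : IsNondegenerate (Φ i) := by
    rw [isNondegenerate_iff, cmTypeRank, ← Embeddings.card (K i) ℂ]
    exact DoubleFlip.typeRank_eq_of_doubleFlip (isCMTypeWith_conj (Φ i)) h6' hflip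
  exact ⟨DoubleFlip.antiSpan_irreducible_of_doubleFlip (isCMTypeWith_conj (Φ i)) h6' hflip,
    (finrank_antiSpan_eq_iff_isNondegenerate i).2 hnd, hnd⟩

/-- **A double-flip field against ANY field of smaller degree: no common constituent** (both orders): `U(Φ_i)` is
irreducible of dimension `[K_i:ℚ]/2 > [K_j:ℚ]/2 ≥ dim U(Φ_j)` — criterion (α) of the tree.
[cite: Gordon1999HodgeAVSurvey, §3 Theorem (proof)] [cite: Serre1977, §2.2] -/
theorem pairwise_of_doubleFlip_of_finrank_lt (Φ : ∀ i, CMType (K i)) {i j : I} (h6 : 6 ≤ finrank ℚ (K i))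
    (hflip : ∀ s t : K i →+* ℂ, t ≠ s → t ≠ (starRingAut : ℂ ≃+* ℂ) • s → ∃ σ : ℂ ≃+* ℂ,
      σ • s = (starRingAut : ℂ ≃+* ℂ) • s ∧ σ • t = (starRingAut : ℂ ≃+* ℂ) • t ∧
      ∀ u : K i →+* ℂ, u ≠ s → u ≠ (starRingAut : ℂ ≃+* ℂ) • s → u ≠ t → u ≠ (starRingAut : ℂ ≃+* ℂ) • t → σ • u = u)
    (hlt : finrank ℚ (K j) < finrank ℚ (K i)) :
    (∀ P : Submodule ℚ ((K j →+* ℂ) → ℚ), P ≤ antiSpan (ℂ ≃+* ℂ) (Φ j).1 →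
      (∀ g : ℂ ≃+* ℂ, ∀ f ∈ P, (fun x => f (g • x)) ∈ P) →
      ∀ T : ((K j →+* ℂ) → ℚ) →ₗ[ℚ] ((K i →+* ℂ) → ℚ),
        (∀ g : ℂ ≃+* ℂ, ∀ f ∈ P, T (fun x => f (g • x)) = fun y => T f (g • y)) →
        (∀ f ∈ P, T f ∈ antiSpan (ℂ ≃+* ℂ) (Φ i).1) → (∀ f ∈ P, T f = 0 → f = 0) → P = ⊥) ∧
    (∀ P : Submodule ℚ ((K i →+* ℂ) → ℚ), P ≤ antiSpan (ℂ ≃+* ℂ) (Φ i).1 →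
      (∀ g : ℂ ≃+* ℂ, ∀ f ∈ P, (fun x => f (g • x)) ∈ P) →
      ∀ T : ((K i →+* ℂ) → ℚ) →ₗ[ℚ] ((K j →+* ℂ) → ℚ),
        (∀ g : ℂ ≃+* ℂ, ∀ f ∈ P, T (fun x => f (g • x)) = fun y => T f (g • y)) →
        (∀ f ∈ P, T f ∈ antiSpan (ℂ ≃+* ℂ) (Φ j).1) → (∀ f ∈ P, T f = 0 → f = 0) → P = ⊥) := by
  obtain ⟨hirr, hdim, -⟩ := irreducible_and_isNondegenerate_of_doubleFlip Φ h6 hflip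
  -- the CM degree `[K_i:ℚ]` is even, so `[K_j:ℚ]/2 < [K_i:ℚ]/2`
  have hi2 := Literature.AlgebraicGeometry.Motives.HodgeStructure.two_mul_ncard_cmType_eq_finrank (Φ i)
  have hlt' : finrank ℚ (antiSpan (ℂ ≃+* ℂ) (Φ j).1) < finrank ℚ (antiSpan (ℂ ≃+* ℂ) (Φ i).1) := by
    have h1 := finrank_antiSpan_le_finrank_div_two (Φ := Φ) j
    rw [hdim]; omega
  exact pairwise_of_irreducible_of_finrank_le (G := ℂ ≃+* ℂ) (Φ := fun i => (Φ i).1) hirr hlt'.le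
    (fun h => absurd h hlt'.ne)

variable [Fintype I] [DecidableEq I]

/-- **Two slots, a double-flip field against any field of smaller degree: nondegenerate iff the smaller type is.**  No
shared-field clause (a double-flip field of degree `≥ 6` has no imaginary quadratic subfield to share).
[cite: Gordon1999HodgeAVSurvey, §3 Theorem and 7.5–7.7] -/
theorem isNondegenerateFamily_iff_of_doubleFlip_of_finrank_lt {i₀ i₁ : I} (h01 : i₀ ≠ i₁)
    (hI : ∀ j, j = i₀ ∨ j = i₁) (h6 : 6 ≤ finrank ℚ (K i₀))
    (hflip : ∀ s t : K i₀ →+* ℂ, t ≠ s → t ≠ (starRingAut : ℂ ≃+* ℂ) • s → ∃ σ : ℂ ≃+* ℂ,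
      σ • s = (starRingAut : ℂ ≃+* ℂ) • s ∧ σ • t = (starRingAut : ℂ ≃+* ℂ) • t ∧
      ∀ u : K i₀ →+* ℂ, u ≠ s → u ≠ (starRingAut : ℂ ≃+* ℂ) • s → u ≠ t → u ≠ (starRingAut : ℂ ≃+* ℂ) • t →
        σ • u = u)
    (hlt : finrank ℚ (K i₁) < finrank ℚ (K i₀)) (Φ : ∀ i, CMType (K i)) :
    CMAlgebra.IsNondegenerateFamily Φ ↔ IsNondegenerate (Φ i₁) := by
  haveI : Nonempty I := ⟨i₀⟩
  have hnd₀ := (irreducible_and_isNondegenerate_of_doubleFlip Φ h6 hflip).2.2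
  have hab := pairwise_of_doubleFlip_of_finrank_lt Φ h6 hflip hlt
  rw [isNondegenerateFamily_iff_forall_of_pairwise Φ fun i j hij => ?_]
  · refine ⟨fun H => H i₁, fun H i => ?_⟩
    rcases hI i with rfl | rfl
    · exact hnd₀
    · exact H
  · rcases hI i with rfl | rfl <;> rcases hI j with rfl | rfl
    · exact absurd rfl hij
    · exact hab.2
    · exact hab.1
    · exact absurd rfl hij

end Fields

/-! ## §3 Abelian varieties: a double-flip factor against smaller factors -/

section Geometry

variable {I : Type} {K : I → Type} [∀ i, Field (K i)] [∀ i, NumberField (K i)] [∀ i, IsCMField (K i)] [Fintype I]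
  [DecidableEq I] {Φ : ∀ i, CMType (K i)}
variable {A : I → AbelianVariety ℂ} {ι : ∀ i, 𝓞 (K i) →+* End (A i)}
  {θ : ∀ i, K i →+* Module.End ℂ (complexBetti (A i).X 1)}

/-- **The Hodge conjecture on every `A^a × B^b`** — `A = A_{i₀}` a CM abelian variety of dimension `≥ 3` whose CM field has
DOUBLE FLIPS, `B = A_{i₁}` any realisation of a NONDEGENERATE type of smaller dimension: the Hodge conjecture and `B• = D•`
on every `⨁_{j<N} A_{π j}`, UNCONDITIONALLY, with no hypothesis relating the two fields.
[cite: Gordon1999HodgeAVSurvey, §3 Theorem and 10.10] -/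
theorem hodgeConjectureFor_prod_of_doubleFlip_of_dim_lt {i₀ i₁ : I} (h01 : i₀ ≠ i₁) (hI : ∀ j, j = i₀ ∨ j = i₁)
    (hA : ∀ i, IsCMTypeRealisation (Φ i) (A i) (ι i) (θ i)) (h3 : 3 ≤ (A i₀).dim) (hlt : (A i₁).dim < (A i₀).dim)
    (hflip : ∀ s t : K i₀ →+* ℂ, t ≠ s → t ≠ (starRingAut : ℂ ≃+* ℂ) • s → ∃ σ : ℂ ≃+* ℂ,
      σ • s = (starRingAut : ℂ ≃+* ℂ) • s ∧ σ • t = (starRingAut : ℂ ≃+* ℂ) • t ∧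
      ∀ u : K i₀ →+* ℂ, u ≠ s → u ≠ (starRingAut : ℂ ≃+* ℂ) • s → u ≠ t → u ≠ (starRingAut : ℂ ≃+* ℂ) • t →
        σ • u = u)
    (hnd₁ : IsNondegenerate (Φ i₁)) {N : ℕ} (π : Fin N → I) :
    HodgeConjectureFor (⨁ fun j : Fin N => A (π j)).dim (⨁ fun j : Fin N => A (π j)).X ∧
      ∀ m : ℕ, hodgeClassSpan (⨁ fun j : Fin N => A (π j)).dim (⨁ fun j : Fin N => A (π j)).X m =
        divisorClassesSpan (⨁ fun j : Fin N => A (π j)).X (⨁ fun j : Fin N => A (π j)).dim m := by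
  haveI : Nonempty I := ⟨i₀⟩
  have h6 : 6 ≤ finrank ℚ (K i₀) := by rw [finrank_eq_two_mul_dim_of_isCMTypeRealisation (hA i₀)]; omega
  have hlt' : finrank ℚ (K i₁) < finrank ℚ (K i₀) := by
    rw [finrank_eq_two_mul_dim_of_isCMTypeRealisation (hA i₀), finrank_eq_two_mul_dim_of_isCMTypeRealisation (hA i₁)]
    omega
  have h := (isNondegenerateFamily_iff_of_doubleFlip_of_finrank_lt h01 hI h6 hflip hlt' Φ).2 hnd₁
  exact ⟨h.hodgeConjectureFor_prod hA π, fun m => h.hodgeClassSpan_prod_eq_divisorClassesSpan hA π m⟩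

/-- **A CM abelian FOURFOLD whose octic field has double flips times ANY SIMPLE CM abelian variety of dimension `≤ 3`
(curve, simple surface, simple threefold): the Hodge conjecture and `B• = D•` on every `F^a × B^b`**, UNCONDITIONALLY and
with no hypothesis on the fields (simple CM abelian varieties of dimension `≤ 3` are nondegenerate, Ribet).  Covers the
octic fields with sign kernel of order `≥ 8` (Galois closures of degree `32, 64, 96, 128, 192, 384`).
[cite: Gordon1999HodgeAVSurvey, §3 Theorem, 7.5–7.7 and 10.10] [cite: Dodson1984, §5.2] -/
theorem hodgeConjectureFor_prod_doubleFlipOctic_simple_dim_le_three {i₀ i₁ : I} (h01 : i₀ ≠ i₁)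
    (hI : ∀ j, j = i₀ ∨ j = i₁) (hA : ∀ i, IsCMTypeRealisation (Φ i) (A i) (ι i) (θ i)) (hd₀ : (A i₀).dim = 4)
    (hd₁ : (A i₁).dim ≤ 3) (hS₁ : (A i₁).IsSimple)
    (hflip : ∀ s t : K i₀ →+* ℂ, t ≠ s → t ≠ (starRingAut : ℂ ≃+* ℂ) • s → ∃ σ : ℂ ≃+* ℂ,
      σ • s = (starRingAut : ℂ ≃+* ℂ) • s ∧ σ • t = (starRingAut : ℂ ≃+* ℂ) • t ∧
      ∀ u : K i₀ →+* ℂ, u ≠ s → u ≠ (starRingAut : ℂ ≃+* ℂ) • s → u ≠ t → u ≠ (starRingAut : ℂ ≃+* ℂ) • t →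
        σ • u = u)
    {N : ℕ} (π : Fin N → I) :
    HodgeConjectureFor (⨁ fun j : Fin N => A (π j)).dim (⨁ fun j : Fin N => A (π j)).X ∧
      ∀ m : ℕ, hodgeClassSpan (⨁ fun j : Fin N => A (π j)).dim (⨁ fun j : Fin N => A (π j)).X m =
        divisorClassesSpan (⨁ fun j : Fin N => A (π j)).X (⨁ fun j : Fin N => A (π j)).dim m := by
  obtain ⟨φ₁⟩ : Nonempty (K i₁ →+* ℂ) := inferInstance
  have h6 : finrank ℚ (K i₁) ≤ 6 := by rw [finrank_eq_two_mul_dim_of_isCMTypeRealisation (hA i₁)]; omega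
  exact hodgeConjectureFor_prod_of_doubleFlip_of_dim_lt h01 hI hA (by omega) (by omega) hflip
    (isNondegenerate_of_isPrimitive_of_finrank_le_six (Φ i₁) h6 φ₁ ((isSimple_iff_isPrimitive (hA i₁) φ₁).1 hS₁)) π

end Geometry

end Summit.HodgeConjecture.CorCM

end
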